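import Literature.MathematicalPhysics.QuantumLattice.Imbrie2016.ZeroCoupling

/-!
# Imbrie (2016): resolving states does not weaken a per-block probability hypothesis — LLA versus its
per-level and per-pair forms (AUDIT-CELL LEMMAS for SURVIVAL.md §3R3, revision 7; build tag b2b, seat b2b-imbrie-2-g7)

CITATION HEADER.  Source audited: J. Z. Imbrie, "On Many-Body Localization for Quantum Spin Chains",
J. Stat. Phys. 163 (2016) 998–1048 = arXiv:1403.7837v3 (bib key ImbrieJSP2016).  Passages (v3 TeX chunk
locators): (1.3) [p0004] and (5.2a) [p0033] (Assumption LLA(ν, C): P(min_{α≠β} |E_α − E_β| < δ) ≤ δ^ν Cⁿ for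
the Hamiltonian of every block of n sites); §5 [p0034 l.5] ("Thus the minimum eigenvalue spacing in (5.2a)
transfers to \bar{\bar E}^{(j')}_α and hence to E^{(j')}_α"), [p0034 l.7] ("… a sum over intermediate states
(no more than exponential in n) and an energy denominator (bounded below by (5.2a))"); [p0021 l.16] ("once a
block variable is linked … it is treated as fixed, along with any other energy difference in the block").
Compared preprint (NOT a source of facts here; arXiv-only, unrefereed): W. De Roeck, A. Hannani,
arXiv:2506.13511v2, Thm 3 (the fraction of levels lying in singleton resonant patches tends to 1).

WHAT THIS FILE IS.  SURVIVAL.md §3R3 asks whether a STATE-RESOLVED weakening of LLA — a hypothesis about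
individual levels α, or about labelled pairs (α, β), which is the form in which a density statement of the
De Roeck–Hannani type is phrased — could stand in for LLA in the printed §5 bridge.  Over the vocabulary of
LLA.lean (labels = Mathlib's eigenvalue indices `Cfg n`, multiplicity counted; any fixed labelling gives the
same implications) this file kernel-checks the elementary half of the answer: with exponential constants Cⁿ
allowed, the three per-block PROBABILITY forms are equivalent up to C ↦ 2C ↦ 4C:
 * `LevelLLA L γ ν C`: ∀ blocks, ∀ δ > 0, ∀ α: P(∃ β ≠ α, |E_α − E_β| < δ) ≤ δ^ν Cⁿ (a per-label
   probability bound, one inequality per α — NOT the simultaneous event "all levels isolated", which is LLA);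
 * `PairLLA L γ ν C`:  ∀ blocks, ∀ δ > 0, ∀ α ≠ β: P(|E_α − E_β| < δ) ≤ δ^ν Cⁿ;
 * `levelLLA_of_LLA`, `pairLLA_of_levelLLA` (monotonicity); `levelLLA_of_pairLLA` (C ↦ 2C: union over the
   ≤ 2ⁿ partners β), `LLA_of_levelLLA` (C ↦ 2C: union over the 2ⁿ levels α), `LLA_of_pairLLA` (C ↦ 4C);
   the common union step is `boxMeasure_biUnion_cfg_le`.
So what separates a DENSITY statement (expected FRACTION of non-isolated levels → 0) from LLA is not the
resolution into states but the replacement of a probability bound δ^ν Cⁿ for EACH level by an average over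
the 2ⁿ levels — the factor 2ⁿ of SURVIVAL.md §3R2 — while the printed §5 bridge consumes the per-block
minimum spacing (5.2a) [p0034 l.5, l.7].  Audit-cell lemmas; not statements of the paper; nothing here bears
on the truth of LLA (open for γ > 0) or says that any part of the paper stands.
-/

namespace Literature.MathematicalPhysics.QuantumLattice.Imbrie2016

open _root_.MeasureTheory Finset
open scoped ENNReal

/-- **Per-level form LevelLLA(ν, C)** of Assumption LLA: for every block [a, a+n−1], every δ > 0 and every
label α SEPARATELY, P(∃ β ≠ α : |E_α − E_β| < δ) ≤ δ^ν Cⁿ (a per-label probability bound; the simultaneous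
event "some level is not δ-isolated" is `SmallGap`, i.e. LLA itself — see `LLA_of_levelLLA` for the cost 2ⁿ).
A cell-side reformulation for SURVIVAL.md §3R3; UNPROVED for γ > 0, never asserted. [cite: ImbrieJSP2016, eq. (1.3) and (5.2a)] -/
def LevelLLA (L : Laws) (γ ν C : ℝ) : Prop :=
  ∀ (a : ℤ) (n : ℕ), 0 < n → ∀ δ : ℝ, 0 < δ → ∀ α : Cfg n,
    L.boxMeasure a n {t | ∃ β : Cfg n, β ≠ α ∧
        |eigs γ (Params.ofTriple t) α - eigs γ (Params.ofTriple t) β| < δ}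
      ≤ ENNReal.ofReal (δ ^ ν * C ^ n)

/-- **Per-pair form PairLLA(ν, C)** of Assumption LLA: for every block, every δ > 0 and every labelled pair
α ≠ β, P(|E_α − E_β| < δ) ≤ δ^ν Cⁿ.  A cell-side reformulation for SURVIVAL.md §3R3; UNPROVED for γ > 0,
never asserted. [cite: ImbrieJSP2016, eq. (1.3) and (5.2a)] -/
def PairLLA (L : Laws) (γ ν C : ℝ) : Prop :=
  ∀ (a : ℤ) (n : ℕ), 0 < n → ∀ δ : ℝ, 0 < δ → ∀ α β : Cfg n, α ≠ β →
    L.boxMeasure a n {t | |eigs γ (Params.ofTriple t) α - eigs γ (Params.ofTriple t) β| < δ}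
      ≤ ENNReal.ofReal (δ ^ ν * C ^ n)

/-- LLA(ν, C) ⟹ LevelLLA(ν, C): the per-level event is contained in the min-gap event. [cite: ImbrieJSP2016, eq. (1.3)] -/
theorem levelLLA_of_LLA {L : Laws} {γ ν C : ℝ} (h : LLA L γ ν C) : LevelLLA L γ ν C := by
  intro a n hn δ hδ α
  refine (measure_mono ?_).trans (h a n hn δ hδ)
  rintro t ⟨β, hne, hlt⟩
  exact ⟨α, β, hne.symm, hlt⟩

/-- LevelLLA(ν, C) ⟹ PairLLA(ν, C): the per-pair event is contained in the per-level event. [cite: ImbrieJSP2016, eq. (1.3)] -/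
theorem pairLLA_of_levelLLA {L : Laws} {γ ν C : ℝ} (h : LevelLLA L γ ν C) : PairLLA L γ ν C := by
  intro a n hn δ hδ α β hne
  refine (measure_mono ?_).trans (h a n hn δ hδ α)
  intro t ht
  exact ⟨β, hne.symm, ht⟩

/-- The common union step: a union over any set of labels (at most 2ⁿ of them, `card_cfg`) of events each of
probability ≤ δ^ν Cⁿ has probability ≤ δ^ν (2C)ⁿ. [cite: ImbrieJSP2016, eq. (1.3)] -/
theorem boxMeasure_biUnion_cfg_le {L : Laws} {a : ℤ} {n : ℕ} {ν C δ : ℝ} (s : Finset (Cfg n))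
    (F : Cfg n → Set ((Fin n → ℝ) × (Fin n → ℝ) × (Fin (n + 1) → ℝ)))
    (hF : ∀ β ∈ s, L.boxMeasure a n (F β) ≤ ENNReal.ofReal (δ ^ ν * C ^ n)) :
    L.boxMeasure a n (⋃ β ∈ s, F β) ≤ ENNReal.ofReal (δ ^ ν * (2 * C) ^ n) := by
  classical
  have hcard : ((s.card : ℕ) : ℝ) ≤ 2 ^ n := by
    have h1 : s.card ≤ Fintype.card (Cfg n) := Finset.card_le_univ s
    rw [card_cfg] at h1
    exact_mod_cast h1
  calc L.boxMeasure a n (⋃ β ∈ s, F β) ≤ ∑ β ∈ s, L.boxMeasure a n (F β) :=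
        measure_biUnion_finset_le _ _
    _ ≤ ∑ β ∈ s, ENNReal.ofReal (δ ^ ν * C ^ n) := Finset.sum_le_sum hF
    _ = (s.card : ℝ≥0∞) * ENNReal.ofReal (δ ^ ν * C ^ n) := by
        rw [Finset.sum_const, nsmul_eq_mul]
    _ ≤ ENNReal.ofReal (2 ^ n) * ENNReal.ofReal (δ ^ ν * C ^ n) := by
        gcongr
        rw [← ENNReal.ofReal_natCast]
        exact ENNReal.ofReal_le_ofReal hcard
    _ = ENNReal.ofReal (δ ^ ν * (2 * C) ^ n) := by
        rw [← ENNReal.ofReal_mul (by positivity), mul_pow]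
        congr 1
        ring

/-- PairLLA(ν, C) ⟹ LevelLLA(ν, 2C): union over the at most 2ⁿ − 1 partners β ≠ α. [cite: ImbrieJSP2016, eq. (1.3)] -/
theorem levelLLA_of_pairLLA {L : Laws} {γ ν C : ℝ} (h : PairLLA L γ ν C) : LevelLLA L γ ν (2 * C) := by
  classical
  intro a n hn δ hδ α
  set F : Cfg n → Set ((Fin n → ℝ) × (Fin n → ℝ) × (Fin (n + 1) → ℝ)) :=
    fun β => {t | |eigs γ (Params.ofTriple t) α - eigs γ (Params.ofTriple t) β| < δ} with hF
  have hsub : {t : (Fin n → ℝ) × (Fin n → ℝ) × (Fin (n + 1) → ℝ) | ∃ β : Cfg n, β ≠ α ∧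
      |eigs γ (Params.ofTriple t) α - eigs γ (Params.ofTriple t) β| < δ}
        ⊆ ⋃ β ∈ (univ : Finset (Cfg n)).erase α, F β := by
    rintro t ⟨β, hne, hlt⟩
    refine Set.mem_iUnion₂.mpr ⟨β, ?_, hlt⟩
    simp [Finset.mem_erase, hne]
  refine (measure_mono hsub).trans (boxMeasure_biUnion_cfg_le _ F ?_)
  intro β hβ
  exact h a n hn δ hδ α β (Finset.mem_erase.mp hβ).1.symm

/-- LevelLLA(ν, C) ⟹ LLA(ν, 2C): union over the 2ⁿ levels α. [cite: ImbrieJSP2016, eq. (1.3)] -/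
theorem LLA_of_levelLLA {L : Laws} {γ ν C : ℝ} (h : LevelLLA L γ ν C) : LLA L γ ν (2 * C) := by
  classical
  intro a n hn δ hδ
  set F : Cfg n → Set ((Fin n → ℝ) × (Fin n → ℝ) × (Fin (n + 1) → ℝ)) :=
    fun α => {t | ∃ β : Cfg n, β ≠ α ∧
      |eigs γ (Params.ofTriple t) α - eigs γ (Params.ofTriple t) β| < δ} with hF
  have hsub : {t : (Fin n → ℝ) × (Fin n → ℝ) × (Fin (n + 1) → ℝ) | SmallGap γ δ (Params.ofTriple t)}
        ⊆ ⋃ α ∈ (univ : Finset (Cfg n)), F α := by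
    rintro t ⟨α, β, hne, hlt⟩
    refine Set.mem_iUnion₂.mpr ⟨α, Finset.mem_univ α, ?_⟩
    show ∃ β' : Cfg n, β' ≠ α ∧ |eigs γ (Params.ofTriple t) α - eigs γ (Params.ofTriple t) β'| < δ
    exact ⟨β, hne.symm, hlt⟩
  refine (measure_mono hsub).trans (boxMeasure_biUnion_cfg_le _ F ?_)
  intro α _
  exact h a n hn δ hδ α

/-- PairLLA(ν, C) ⟹ LLA(ν, 4C): the ≤ 4ⁿ ordered pairs of labels.  Together with `levelLLA_of_LLA` and
`pairLLA_of_levelLLA`: LLA, LevelLLA and PairLLA are the same hypothesis up to C ↦ 4C — resolving states does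
not weaken a per-block probability hypothesis with exponential constants (SURVIVAL.md §3R3). [cite: ImbrieJSP2016, eq. (1.3) and (5.2a)] -/
theorem LLA_of_pairLLA {L : Laws} {γ ν C : ℝ} (h : PairLLA L γ ν C) : LLA L γ ν (4 * C) := by
  rw [show (4 : ℝ) * C = 2 * (2 * C) by ring]
  exact LLA_of_levelLLA (levelLLA_of_pairLLA h)

/-- The three forms at the SAME constants when read modulo C ↦ 4C: LLA(ν, C) ⟹ PairLLA(ν, C) ⟹ LLA(ν, 4C).
[cite: ImbrieJSP2016, eq. (1.3) and (5.2a)] -/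
theorem LLA_pair_sandwich {L : Laws} {γ ν C : ℝ} :
    (LLA L γ ν C → PairLLA L γ ν C) ∧ (PairLLA L γ ν C → LLA L γ ν (4 * C)) :=
  ⟨fun h => pairLLA_of_levelLLA (levelLLA_of_LLA h), LLA_of_pairLLA⟩

end Literature.MathematicalPhysics.QuantumLattice.Imbrie2016
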